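import Summits.Schanuel.Schanuel.Theorems.RootDecomp1BRadicalDescent05
import Summits.Schanuel.Schanuel.Theses.RootDecomp1B

/-!
# RootDecomp1BRadicalDescent — lens 4, generations 30–31 «RADICAL DESCENT / STOREY-TWO CELLS» (RadicalDescent.lean g31 47a8f674…, 1887 l) — continuation (RootDecomp1BRadicalDescent06): §G (gen 31, VARIANT per B-R19) the NAMED MEMBER `ρ_U = Σ_k 2^{-u_k}` — `ultraLiouville_rhoU` hypothesis-free, `linearIndependent_one_rhoU`, and the §E cells at `(1, ρ_U)`: `four_le_polarDeg_one_rhoU`, `kleinPolarSchanuel_instance_rhoU`, `storey_two_cell_rhoU`; the three LIVE LINKS to item 24622 (`kleinPolarSchanuel_instance_shape`, `_column_shape`, `_instance_rhoU`; this part alone imports `…Theses.RootDecomp1B`)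

(lens-4 g30/g31 `RadicalDescent.lean`, sha256 47a8f674…751d, own farm rc 0 · 0 sorry · axioms std; critic VERDICT STATUS L1626 (d) PORT GO LOW, SOURCE UPDATE L1648;
port by census-1 gen 15 in six parts `RootDecomp1BRadicalDescent01`–`06` — see the PORT NOTE of part 01; `--supports stmt-Schanuel-24622`; rung 0.)
-/

noncomputable section

open Complex

namespace Summit.Schanuel.Schanuel.Theorems.RootDecomp1BRadicalDescent

/-! ## §G  A NAMED MEMBER — the tower number `ρ_U = Σ_k 2^{-u_k}` is ultra-Liouville (hypothesis-free)

Generation 31 addendum (critic VERDICT L1626: «a NAMED member … would be a welcome port-time addition — VARIANT, no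
credit»; RULE B-R19: same cell class).  Tower exponents `u 0 = 1`, `u (k+1) = 4 · 3^(3^((k+1)·u k))`; the `K`-th
partial sum is the rational `s_K = N_K / 2^{u_K}` with `N_K = Σ_{k ≤ K} 2^{u_K − u_k}` ODD, so `den s_K = 2^{u_K}`
(`uRat_den`); the tail satisfies `0 < ρ_U − s_K ≤ 2 · 2^{−u_{K+1}}` (`tail_pos`, `tail_le`), and the tower growth
`2 · exp(exp(2^{K·u_K})) < 2^{u_{K+1}}` (`two_mul_exp_exp_lt`: `exp N ≤ 3^N`, `2^{K u_K} ≤ 3^{(K+1) u_K}`,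
`2 · 3^Y < 16^Y`) gives `|ρ_U − s_K| < exp(−exp((den s_K)^K))` at every order `K`: `ultraLiouville_rhoU`.
Hence every §E cell holds AT THE EXPLICIT PAIR `(1, ρ_U)` (mod `hLW`): `four_le_polarDeg_one_rhoU` etc., and
`storey_two_cell_rhoU` is an explicit witness of `exists_storey_two_cell`. -/

section NamedMember

open Finset

/-- The tower exponents `u 0 = 1`, `u (k+1) = 4 · 3^(3^((k+1)·u k))`. -/
def uTow : ℕ → ℕ
  | 0 => 1
  | k + 1 => 4 * 3 ^ (3 ^ ((k + 1) * uTow k))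

/-- `u 0 = 1`. -/
@[simp] theorem uTow_zero : uTow 0 = 1 := rfl

/-- `u (k+1) = 4 · 3^(3^((k+1) · u k))`. -/
theorem uTow_succ (k : ℕ) : uTow (k + 1) = 4 * 3 ^ (3 ^ ((k + 1) * uTow k)) := rfl

/-- The tower exponents are strictly increasing: `u k < u (k+1)`. -/
theorem uTow_lt_succ (k : ℕ) : uTow k < uTow (k + 1) := by
  rw [uTow_succ]
  have h1 : uTow k ≤ (k + 1) * uTow k := Nat.le_mul_of_pos_left _ (Nat.succ_pos k)
  have h2 : (k + 1) * uTow k < 3 ^ ((k + 1) * uTow k) := Nat.lt_pow_self (by norm_num)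
  have h3 : 3 ^ ((k + 1) * uTow k) < 3 ^ (3 ^ ((k + 1) * uTow k)) := Nat.pow_lt_pow_right (by norm_num) h2
  have h4 : 3 ^ (3 ^ ((k + 1) * uTow k)) ≤ 4 * 3 ^ (3 ^ ((k + 1) * uTow k)) := Nat.le_mul_of_pos_left _ (by norm_num)
  omega

/-- `uTow` is strictly monotone. -/
theorem uTow_strictMono : StrictMono uTow := strictMono_nat_of_lt_succ uTow_lt_succ

/-- `k ≤ u k`. -/
theorem le_uTow (k : ℕ) : k ≤ uTow k := by
  induction k with
  | zero => simp
  | succ k ih => have := uTow_lt_succ k; omega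

/-- `u (K+1) + j ≤ u (j + K + 1)`. -/
theorem uTow_add_le (K j : ℕ) : uTow (K + 1) + j ≤ uTow (j + (K + 1)) := by
  induction j with
  | zero => simp
  | succ j ih =>
    have := uTow_lt_succ (j + (K + 1))
    rw [show j + 1 + (K + 1) = j + (K + 1) + 1 by ring]
    omega

/-- the terms `2^{-u_k}` -/
def uTerm (k : ℕ) : ℝ := ((1 : ℝ) / 2) ^ uTow k

/-- The terms `2^{-u_k}` are positive. -/
theorem uTerm_pos (k : ℕ) : 0 < uTerm k := by unfold uTerm; positivity

/-- `2^{-u_k} ≤ (1/2)^k`. -/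
theorem uTerm_le_geom (k : ℕ) : uTerm k ≤ ((1 : ℝ) / 2) ^ k :=
  pow_le_pow_of_le_one (by norm_num) (by norm_num) (le_uTow k)

/-- The series `Σ_k 2^{-u_k}` is summable. -/
theorem summable_uTerm : Summable uTerm :=
  Summable.of_nonneg_of_le (fun k => (uTerm_pos k).le) uTerm_le_geom summable_geometric_two

/-- **`ρ_U := Σ_k 2^{-u_k}`**, the named ultra-Liouville member. -/
def rhoU : ℝ := ∑' k, uTerm k

/-- numerator of the `K`-th partial sum: `N_K = Σ_{k ≤ K} 2^{u_K − u_k}` (odd). -/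
def uNum (K : ℕ) : ℕ := ∑ k ∈ range (K + 1), 2 ^ (uTow K - uTow k)

/-- the `K`-th partial sum as a rational `N_K / 2^{u_K}`. -/
def uRat (K : ℕ) : ℚ := (uNum K : ℚ) / 2 ^ uTow K

/-- The `K`-th partial sum of `Σ 2^{-u_k}` is the rational `uRat K = N_K / 2^{u_K}`. -/
theorem sum_uTerm_eq (K : ℕ) : ∑ k ∈ range (K + 1), uTerm k = ((uRat K : ℚ) : ℝ) := by
  unfold uRat uNum uTerm
  push_cast
  rw [Finset.sum_div]
  refine Finset.sum_congr rfl fun k hk => ?_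
  have hk' : uTow k ≤ uTow K := uTow_strictMono.monotone (Nat.lt_succ_iff.mp (mem_range.mp hk))
  rw [one_div_pow, pow_sub₀ (2 : ℝ) two_ne_zero hk']
  field_simp

/-- The numerator `N_K` is odd. -/
theorem uNum_odd (K : ℕ) : Odd (uNum K) := by
  unfold uNum
  rw [Finset.sum_range_succ, Nat.sub_self, pow_zero]
  have hdvd : 2 ∣ ∑ k ∈ range K, 2 ^ (uTow K - uTow k) := by
    refine Finset.dvd_sum fun k hk => ?_
    have hk' : uTow k < uTow K := uTow_strictMono (mem_range.mp hk)
    rw [show uTow K - uTow k = (uTow K - uTow k - 1) + 1 by omega, pow_succ]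
    exact dvd_mul_left 2 _
  obtain ⟨c, hc⟩ := hdvd
  exact ⟨c, by rw [hc]⟩

/-- The `K`-th partial sum has denominator exactly `2^{u_K}` (since `N_K` is odd). -/
theorem uRat_den (K : ℕ) : (uRat K).den = 2 ^ uTow K := by
  have hcop : Nat.Coprime (uNum K) (2 ^ uTow K) := Nat.Coprime.pow_right _ (uNum_odd K).coprime_two_right
  have h := Rat.den_div_eq_of_coprime (a := (uNum K : ℤ)) (b := ((2 ^ uTow K : ℕ) : ℤ))
    (by positivity) (by simpa using hcop)
  have hq : ((uNum K : ℤ) : ℚ) / (((2 ^ uTow K : ℕ) : ℤ) : ℚ) = uRat K := by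
    unfold uRat; push_cast; rfl
  rw [hq] at h
  exact_mod_cast h

/-- The shifted tails `k ↦ 2^{-u_{k+K+1}}` are summable. -/
theorem summable_uTerm_shift (K : ℕ) : Summable fun j : ℕ => uTerm (j + (K + 1)) :=
  (summable_nat_add_iff (K + 1)).mpr summable_uTerm

/-- `ρ_U` minus its `K`-th partial sum is the tail `Σ_{j} 2^{-u_{j+K+1}}`. -/
theorem rhoU_sub_uRat (K : ℕ) : rhoU - (uRat K : ℝ) = ∑' j, uTerm (j + (K + 1)) := by
  rw [← sum_uTerm_eq, rhoU, ← summable_uTerm.sum_add_tsum_nat_add (K + 1)]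
  ring

/-- The tails of `Σ 2^{-u_k}` are positive. -/
theorem tail_pos (K : ℕ) : 0 < ∑' j, uTerm (j + (K + 1)) :=
  (summable_uTerm_shift K).tsum_pos (fun _ => (uTerm_pos _).le) 0 (uTerm_pos _)

/-- Tail bound: `Σ_j 2^{-u_{j+K+1}} ≤ 2 · 2^{-u_{K+1}}`. -/
theorem tail_le (K : ℕ) : ∑' j, uTerm (j + (K + 1)) ≤ ((1 : ℝ) / 2) ^ uTow (K + 1) * 2 := by
  have hg : Summable fun j : ℕ => ((1 : ℝ) / 2) ^ uTow (K + 1) * ((1 : ℝ) / 2) ^ j :=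
    summable_geometric_two.mul_left _
  calc ∑' j, uTerm (j + (K + 1)) ≤ ∑' j : ℕ, ((1 : ℝ) / 2) ^ uTow (K + 1) * ((1 : ℝ) / 2) ^ j :=
        (summable_uTerm_shift K).tsum_le_tsum (fun j => by
          unfold uTerm
          rw [← pow_add]
          exact pow_le_pow_of_le_one (by norm_num) (by norm_num) (uTow_add_le K j)) hg
    _ = ((1 : ℝ) / 2) ^ uTow (K + 1) * 2 := by
        rw [summable_geometric_two.tsum_mul_left, tsum_geometric_two]

/-- `exp N ≤ 3^N` for naturals `N`. -/
private theorem exp_nat_le_three_pow (N : ℕ) : Real.exp (N : ℝ) ≤ (3 : ℝ) ^ N := by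
  rw [← mul_one (N : ℝ), Real.exp_nat_mul]
  exact pow_le_pow_left₀ (Real.exp_pos 1).le (Real.exp_one_lt_d9.le.trans (by norm_num)) N

/-- THE GROWTH INEQUALITY of the tower: `2 · exp(exp(2^{m·u_m})) < 2^{u_{m+1}}`. -/
theorem two_mul_exp_exp_lt (m : ℕ) :
    2 * Real.exp (Real.exp ((2 : ℝ) ^ (uTow m * m))) < (2 : ℝ) ^ uTow (m + 1) := by
  set B : ℕ := 3 ^ ((m + 1) * uTow m) with hB
  have hmul : uTow m * m ≤ (m + 1) * uTow m := by nlinarith [Nat.zero_le (uTow m)]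
  have hAB : 2 ^ (uTow m * m) ≤ B :=
    (Nat.pow_le_pow_left (by norm_num : 2 ≤ 3) _).trans (Nat.pow_le_pow_right (by norm_num) hmul)
  have h1 : Real.exp ((2 : ℝ) ^ (uTow m * m)) ≤ (3 : ℝ) ^ B := by
    have := exp_nat_le_three_pow (2 ^ (uTow m * m))
    push_cast at this
    exact this.trans (pow_le_pow_right₀ (by norm_num) hAB)
  have h2 : Real.exp (Real.exp ((2 : ℝ) ^ (uTow m * m))) ≤ (3 : ℝ) ^ (3 ^ B) := by
    refine (Real.exp_le_exp.2 h1).trans ?_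
    have := exp_nat_le_three_pow (3 ^ B)
    push_cast at this
    exact this
  have hY1 : 1 ≤ 3 ^ B := Nat.one_le_pow _ _ (by norm_num)
  have h3 : 2 * 3 ^ (3 ^ B) < 2 ^ (4 * 3 ^ B) := by
    have hlt : 3 ^ (3 ^ B) < 4 ^ (3 ^ B) := Nat.pow_lt_pow_left (by norm_num) (by omega)
    calc 2 * 3 ^ (3 ^ B) < 2 * 4 ^ (3 ^ B) := by linarith
      _ = 2 ^ (2 * 3 ^ B + 1) := by rw [pow_succ, pow_mul]; ring
      _ ≤ 2 ^ (4 * 3 ^ B) := Nat.pow_le_pow_right (by norm_num) (by omega)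
  have h3' : (2 : ℝ) * (3 : ℝ) ^ (3 ^ B) < (2 : ℝ) ^ (4 * 3 ^ B) := by exact_mod_cast h3
  rw [uTow_succ, ← hB]
  calc 2 * Real.exp (Real.exp ((2 : ℝ) ^ (uTow m * m))) ≤ 2 * (3 : ℝ) ^ (3 ^ B) := by linarith [h2]
    _ < (2 : ℝ) ^ (4 * 3 ^ B) := h3'

/-- the tail beats the ultra-Liouville threshold at order `m` -/
theorem tail_lt_threshold (m : ℕ) :
    ((1 : ℝ) / 2) ^ uTow (m + 1) * 2 < Real.exp (-Real.exp ((((2 ^ uTow m : ℕ) : ℕ) : ℝ) ^ m)) := by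
  have hcast : (((2 ^ uTow m : ℕ) : ℕ) : ℝ) ^ m = (2 : ℝ) ^ (uTow m * m) := by
    push_cast
    rw [pow_mul]
  rw [hcast]
  have key := two_mul_exp_exp_lt m
  have hpos : 0 < Real.exp (Real.exp ((2 : ℝ) ^ (uTow m * m))) := Real.exp_pos _
  calc ((1 : ℝ) / 2) ^ uTow (m + 1) * 2 = 2 / (2 : ℝ) ^ uTow (m + 1) := by rw [one_div_pow]; ring
    _ < 2 / (2 * Real.exp (Real.exp ((2 : ℝ) ^ (uTow m * m)))) :=
        div_lt_div_of_pos_left two_pos (by positivity) key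
    _ = Real.exp (-Real.exp ((2 : ℝ) ^ (uTow m * m))) := by
        rw [Real.exp_neg]
        field_simp

/-- **THE NAMED MEMBER IS ULTRA-LIOUVILLE** (hypothesis-free). -/
theorem ultraLiouville_rhoU : UltraLiouville rhoU := by
  intro m
  have htail : rhoU - (uRat m : ℝ) = ∑' j, uTerm (j + (m + 1)) := rhoU_sub_uRat m
  have hpos : 0 < rhoU - (uRat m : ℝ) := by rw [htail]; exact tail_pos m
  refine ⟨uRat m, ?_, ?_, ?_⟩
  · rw [uRat_den]
    exact (le_uTow m).trans Nat.lt_two_pow_self.le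
  · intro h
    rw [h, sub_self] at hpos
    exact lt_irrefl _ hpos
  · rw [abs_of_pos hpos, htail, uRat_den]
    exact (tail_le m).trans_lt (tail_lt_threshold m)

/-- `ρ_U > 0`. -/
theorem rhoU_pos : 0 < rhoU :=
  summable_uTerm.tsum_pos (fun k => (uTerm_pos k).le) 0 (uTerm_pos 0)

/-- `ρ_U < 1`. -/
theorem rhoU_lt_one : rhoU < 1 := by
  have h0 : rhoU - (uRat 0 : ℝ) ≤ ((1 : ℝ) / 2) ^ uTow 1 * 2 := by rw [rhoU_sub_uRat]; exact tail_le 0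
  have h1 : ((uRat 0 : ℚ) : ℝ) = 1 / 2 := by
    rw [← sum_uTerm_eq]
    simp [uTerm]
  have h2 : ((1 : ℝ) / 2) ^ uTow 1 * 2 ≤ ((1 : ℝ) / 2) ^ 3 * 2 := by
    have h108 : uTow 1 = 108 := by simp [uTow_succ]
    have : 3 ≤ uTow 1 := by omega
    have := pow_le_pow_of_le_one (by norm_num : (0 : ℝ) ≤ 1 / 2) (by norm_num) this
    linarith
  rw [h1] at h0
  nlinarith

end NamedMember

section NamedCells

open Summit.Schanuel.Schanuel.Theorems.RootDecomp1KHyper (LWMeasure)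
open Summit.Schanuel.Schanuel.Theorems.RootDecomp1BFedFlagCore (polarDeg)
open Summit.Schanuel.Schanuel.Theorems.RootDecomp1BDefectFloorDefs (SharpRelativeLindemannAt TameDefectZeroAt
  WildSharpDefectZeroAt WildSharpDefectZeroInitAt)

/-- `(1, ρ_U)` is `ℚ`-free (hypothesis-free). -/
theorem linearIndependent_one_rhoU : LinearIndependent ℚ ![(1 : ℝ), rhoU] :=
  linearIndependent_one_of_irrational ultraLiouville_rhoU.irrational

/-- `ρ_U` is transcendental… indeed irrational, Liouville, hyper- and ultra-Liouville (hypothesis-free). -/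
theorem irrational_rhoU : Irrational rhoU := ultraLiouville_rhoU.irrational

/-- **THE STOREY-TWO TUPLE AT THE NAMED MEMBER.** `(e^{ρ_U}, ρ_U, e, e^{i})` is algebraically independent
over `ℚ` (mod `hLW`). -/
theorem algebraicIndependent_four_rhoU (hLW : LWMeasure) :
    AlgebraicIndependent ℚ
      (Fin.cons (cexp ((rhoU : ℂ) * 1)) (Fin.cons (rhoU : ℂ) (fun i => cexp (![(1 : ℂ), Complex.I] i))) :
        Fin (2 + 2) → ℂ) :=
  algebraicIndependent_four_of_pos hLW ultraLiouville_rhoU rhoU_pos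

/-- **X(2)(1, ρ_U): `t(1, ρ_U) ≥ 4`** at the explicit pair (mod `hLW`). -/
theorem four_le_polarDeg_one_rhoU (hLW : LWMeasure) :
    ((2 + 2 : ℕ) : Cardinal) ≤ polarDeg ![(1 : ℝ), rhoU] :=
  four_le_polarDeg_one_ultra hLW ultraLiouville_rhoU

/-- The same in the VERBATIM shape of the body of the 1B crux `KleinPolarSchanuel` (item 24622) at `m = 2`,
`r = (1, ρ_U)`. -/
theorem kleinPolarSchanuel_body_two_one_rhoU (hLW : LWMeasure) :
    ((2 + 2 : ℕ) : Cardinal) ≤ Algebra.trdeg ℚ ↥(IntermediateField.adjoin ℚ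
      (Set.range (Fin.append (fun j => ((![(1 : ℝ), rhoU] j : ℝ) : ℂ))
          (fun j => ((![(1 : ℝ), rhoU] j : ℝ) : ℂ) * Complex.I)) ∪
        Set.range (Complex.exp ∘ Fin.append (fun j => ((![(1 : ℝ), rhoU] j : ℝ) : ℂ))
          (fun j => ((![(1 : ℝ), rhoU] j : ℝ) : ℂ) * Complex.I)))) :=
  four_le_polarDeg_one_ultra hLW ultraLiouville_rhoU

-- PORT (census-1 gen 15): the two LIVE-LINK theorems of §E / §F (`kleinPolarSchanuel_instance_shape`,
-- `kleinPolarSchanuel_column_shape`) are moved here so that only this last part imports `…Theses.RootDecomp1B` (critic L1626 (d)).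

/-- LIVE LINK (converse direction, bookkeeping): the cell is exactly the `m = 2`, `r = (1, ρ)` instance of the
route crux `RootDecomp1B.KleinPolarSchanuel` (stmt-Schanuel-24622). -/
theorem kleinPolarSchanuel_instance_shape (hX : Summit.Schanuel.Schanuel.Theses.RootDecomp1B.KleinPolarSchanuel)
    (ρ : ℝ) (hli : LinearIndependent ℚ ![(1 : ℝ), ρ]) :
    ((2 + 2 : ℕ) : Cardinal) ≤ polarDeg ![(1 : ℝ), ρ] :=
  hX 2 ![(1 : ℝ), ρ] hli

/-- LIVE LINK: the column cells are exactly instances of the route crux (item 24622) at `m + 1`. -/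
theorem kleinPolarSchanuel_column_shape (hX : Summit.Schanuel.Schanuel.Theses.RootDecomp1B.KleinPolarSchanuel)
    {m : ℕ} (β : Fin m → ℝ) (u : ℝ) (hfree : LinearIndependent ℚ (Fin.snoc β u : Fin (m + 1) → ℝ)) :
    ((m + 1 + (m + 1) : ℕ) : Cardinal) ≤ polarDeg (Fin.snoc β u : Fin (m + 1) → ℝ) :=
  hX (m + 1) (Fin.snoc β u) hfree

/-- the item-24622 instance at the named pair, read off the live crux (converse bookkeeping). -/
theorem kleinPolarSchanuel_instance_rhoU (hX : Summit.Schanuel.Schanuel.Theses.RootDecomp1B.KleinPolarSchanuel) :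
    ((2 + 2 : ℕ) : Cardinal) ≤ polarDeg ![(1 : ℝ), rhoU] :=
  hX 2 ![(1 : ℝ), rhoU] linearIndependent_one_rhoU

/-- **SRLAt (1 | ρ_U)** (item 32406's step at the named pair). -/
theorem sharpRelativeLindemannAt_one_rhoU (hLW : LWMeasure) : SharpRelativeLindemannAt 1 ![(1 : ℝ), rhoU] :=
  sharpRelativeLindemannAt_one_ultra hLW ultraLiouville_rhoU

/-- **T0At (1 | ρ_U)** (item 32407's step at the named pair). -/
theorem tameDefectZeroAt_one_rhoU (hLW : LWMeasure) : TameDefectZeroAt 1 ![(1 : ℝ), rhoU] :=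
  tameDefectZeroAt_one_ultra hLW ultraLiouville_rhoU

/-- **W0At (1 | ρ_U)** (item 32408's step at the named pair). -/
theorem wildSharpDefectZeroAt_one_rhoU (hLW : LWMeasure) : WildSharpDefectZeroAt 1 ![(1 : ℝ), rhoU] :=
  wildSharpDefectZeroAt_one_ultra hLW ultraLiouville_rhoU

/-- **W0InitAt (1 | ρ_U)**. -/
theorem wildSharpDefectZeroInitAt_one_rhoU (hLW : LWMeasure) : WildSharpDefectZeroInitAt 1 ![(1 : ℝ), rhoU] :=
  wildSharpDefectZeroInitAt_one_ultra hLW ultraLiouville_rhoU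

/-- **EXPLICIT STOREY-TWO CELL**: the named real `ρ_U > 0` is irrational, `(1, ρ_U)` is `ℚ`-free, and
`t(1, ρ_U) ≥ 4` (mod `hLW`) — an explicit witness for `exists_storey_two_cell`. -/
theorem storey_two_cell_rhoU (hLW : LWMeasure) :
    0 < rhoU ∧ Irrational rhoU ∧ LinearIndependent ℚ ![(1 : ℝ), rhoU] ∧
      ((2 + 2 : ℕ) : Cardinal) ≤ polarDeg ![(1 : ℝ), rhoU] :=
  ⟨rhoU_pos, irrational_rhoU, linearIndependent_one_rhoU, four_le_polarDeg_one_rhoU hLW⟩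

end NamedCells

end Summit.Schanuel.Schanuel.Theorems.RootDecomp1BRadicalDescent

end
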